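import Mathlib
import Literature.Analysis.Complex.LoewnerLemma

/-!
# Crux-triage r1/k2 evidence — the typed first lemma `FoliationIdentification` of card
`left-passage-foliation-lock` (crux stmt-CriticalPhenomena-11389, ideator 3; tree file
`Summits/CriticalPhenomena/CardyFormulaZ2/Cruxes/ParafermionToSLESixFamilies/FirstLemmasIdeator3.lean`,
decl `Sketch.FoliationIdentification`) is FALSE as stated: it omits the bound `0 ≤ ℓ ≤ 1`
(automatic for a left-passage probability, but not typed).

Witness on the unit disc with the arc `(0, π)`: `H = ℓ = arcHM 0 π + K`, `G = id`, where
`K w = Re((1 + w)/(1 - w))` is the Poisson kernel with pole at `1 = e^{i0}` (an ENDPOINT of the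
arc): `K` is harmonic on the disc, tends to `0` at every boundary point other than `1` (so all four
boundary hypotheses hold — they only concern the two OPEN arcs), and is unbounded along the radius
to `1`, while `arcHM ∈ [0, 1]`; hence `H ≠ c₀ + c₁·arcHM`.

Repair (recorded, not proved): add `∀ z ∈ ball 0 1, ℓ z ∈ Set.Icc 0 1`
(`FoliationIdentificationBdd`); the card's own three-step argument (cross-cuts ⇒ `G` bounded on
`[ε,1-ε]`; Lindelöf on the bands `{1/2 < ℓ < τ}` whose closures meet the circle only at the two
endpoints + Carleman monotonicity ⇒ `G` bounded near `0,1` ⇒ `H` bounded; Fatou radial limits ⇒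
`G(0⁺), G(1⁻)` exist ⇒ `H` = Poisson integral of two constants) goes through for it.
-/

noncomputable section

open Set Filter Metric Topology Complex InnerProductSpace
open scoped Real

namespace Summit.CriticalPhenomena.CardyFormulaZ2.Cruxes.ParafermionToSLESixFamilies.Triage

/-- Verbatim copy of `Sketch.FoliationIdentification` (FirstLemmasIdeator3.lean, ideator 3). -/
def FoliationIdentification : Prop :=
  ∀ (α β : ℝ), α < β → β - α < 2 * π →
    ∀ (H ℓ : ℂ → ℝ) (G : ℝ → ℝ),
      InnerProductSpace.HarmonicOnNhd H (ball (0 : ℂ) 1) →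
      ContinuousOn ℓ (ball (0 : ℂ) 1) →
      (∀ t ∈ Ioo α β, Tendsto ℓ (𝓝[ball (0 : ℂ) 1] (exp (t * I))) (𝓝 1)) →
      (∀ t ∈ Ioo β (α + 2 * π), Tendsto ℓ (𝓝[ball (0 : ℂ) 1] (exp (t * I))) (𝓝 0)) →
      (∀ z ∈ ball (0 : ℂ) 1, H z = G (ℓ z)) →
      ∃ c₀ c₁ : ℝ, ∀ z ∈ ball (0 : ℂ) 1,
        H z = c₀ + c₁ * Literature.Analysis.Complex.arcHM α β z

/-- The repaired statement (add the range hypothesis `ℓ ∈ [0,1]`). Not proved here. -/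
def FoliationIdentificationBdd : Prop :=
  ∀ (α β : ℝ), α < β → β - α < 2 * π →
    ∀ (H ℓ : ℂ → ℝ) (G : ℝ → ℝ),
      InnerProductSpace.HarmonicOnNhd H (ball (0 : ℂ) 1) →
      ContinuousOn ℓ (ball (0 : ℂ) 1) →
      (∀ z ∈ ball (0 : ℂ) 1, ℓ z ∈ Icc (0 : ℝ) 1) →
      (∀ t ∈ Ioo α β, Tendsto ℓ (𝓝[ball (0 : ℂ) 1] (exp (t * I))) (𝓝 1)) →
      (∀ t ∈ Ioo β (α + 2 * π), Tendsto ℓ (𝓝[ball (0 : ℂ) 1] (exp (t * I))) (𝓝 0)) →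
      (∀ z ∈ ball (0 : ℂ) 1, H z = G (ℓ z)) →
      ∃ c₀ c₁ : ℝ, ∀ z ∈ ball (0 : ℂ) 1,
        H z = c₀ + c₁ * Literature.Analysis.Complex.arcHM α β z

/-- Poisson kernel of the unit disc with pole at `1`. -/
def K (w : ℂ) : ℝ := ((1 + w) / (1 - w)).re

/-- The witness `H = ℓ = arcHM 0 π + K`. -/
def Hf (w : ℂ) : ℝ := Literature.Analysis.Complex.arcHM 0 π w + K w

theorem one_sub_ne_zero_of_mem_ball {w : ℂ} (hw : w ∈ ball (0 : ℂ) 1) : (1 : ℂ) - w ≠ 0 := by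
  intro h
  have h1 : (1 : ℂ) = w := sub_eq_zero.1 h
  rw [mem_ball_zero_iff, ← h1, norm_one] at hw
  exact lt_irrefl _ hw

theorem harmonicAt_K {w : ℂ} (hw : (1 : ℂ) - w ≠ 0) : HarmonicAt K w := by
  have ha : AnalyticAt ℂ (fun w : ℂ => (1 + w) / (1 - w)) w :=
    (analyticAt_const.add analyticAt_id).div (analyticAt_const.sub analyticAt_id) hw
  exact ha.harmonicAt_re

theorem continuousAt_K {w : ℂ} (hw : (1 : ℂ) - w ≠ 0) : ContinuousAt K w := by
  have hc : ContinuousAt (fun w : ℂ => (1 + w) / (1 - w)) w :=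
    (continuousAt_const.add continuousAt_id).div (continuousAt_const.sub continuousAt_id) hw
  exact Complex.continuous_re.continuousAt.comp hc

/-- `K` vanishes on the unit circle (at the pole by the junk value `0/0 = 0`). -/
theorem K_exp_mul_I (t : ℝ) : K (exp (t * I)) = 0 := by
  have h := congrFun (poissonKernel_eq_re_herglotzRieszKernel (c := (0 : ℂ)) (w := exp (t * I))) 1
  simp only [Function.comp_apply, herglotzRieszKernel, poissonKernel, sub_zero, norm_one,
    norm_exp_ofReal_mul_I, one_pow, sub_self, zero_div] at h
  rw [K]
  linarith [h]

/-- Along the radius to the pole, `K r = (1 + r)/(1 - r)`. -/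
theorem K_ofReal (r : ℝ) : K (r : ℂ) = (1 + r) / (1 - r) := by
  rw [K, show ((1 : ℂ) + r) / (1 - r) = (((1 + r) / (1 - r) : ℝ) : ℂ) by push_cast; ring,
    ofReal_re]

theorem harmonicOnNhd_Hf : HarmonicOnNhd Hf (ball (0 : ℂ) 1) := by
  intro w hw
  have h1 := Literature.Analysis.Complex.harmonicOnNhd_arcHM (α := 0) (β := π) Real.pi_pos
    (by linarith [Real.pi_pos]) w hw
  have h2 := harmonicAt_K (one_sub_ne_zero_of_mem_ball hw)
  exact h1.add h2

theorem continuousOn_Hf : ContinuousOn Hf (ball (0 : ℂ) 1) := by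
  intro w hw
  have h1 := Literature.Analysis.Complex.continuousAt_arcHM (α := 0) (β := π) Real.pi_pos
    (by linarith [Real.pi_pos]) hw
  have h2 := continuousAt_K (one_sub_ne_zero_of_mem_ball hw)
  exact (h1.add h2).continuousWithinAt

theorem tendsto_K_zero {t : ℝ} (h0 : 0 < t) (h2 : t < 2 * π) :
    Tendsto K (𝓝[ball (0 : ℂ) 1] (exp (t * I))) (𝓝 0) := by
  have hne : exp (t * I) ≠ exp ((0 : ℝ) * I) :=
    Literature.Analysis.Complex.exp_mul_I_ne_of_lt h0 (by linarith)
  have h1 : exp ((0 : ℝ) * I) = 1 := by simp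
  have hne' : (1 : ℂ) - exp (t * I) ≠ 0 :=
    sub_ne_zero.2 (fun h3 => hne (by rw [h1]; exact h3.symm))
  have h4 := (continuousAt_K hne').tendsto
  rw [K_exp_mul_I] at h4
  exact h4.mono_left nhdsWithin_le_nhds

theorem tendsto_Hf_one (t : ℝ) (ht : t ∈ Ioo (0 : ℝ) π) :
    Tendsto Hf (𝓝[ball (0 : ℂ) 1] (exp (t * I))) (𝓝 1) := by
  have h1 := Literature.Analysis.Complex.tendsto_arcHM_one (α := 0) (β := π)
    (by linarith [Real.pi_pos]) ht
  have h2 := tendsto_K_zero (t := t) ht.1 (by linarith [ht.2, Real.pi_pos])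
  have h3 := h1.add h2
  rw [add_zero] at h3
  exact h3

theorem tendsto_Hf_zero (t : ℝ) (ht : t ∈ Ioo π ((0 : ℝ) + 2 * π)) :
    Tendsto Hf (𝓝[ball (0 : ℂ) 1] (exp (t * I))) (𝓝 0) := by
  have h1 := Literature.Analysis.Complex.tendsto_arcHM_zero (α := 0) (β := π) Real.pi_pos ht
  have h2 := tendsto_K_zero (t := t) (by linarith [ht.1, Real.pi_pos]) (by linarith [ht.2])
  have h3 := h1.add h2
  rw [add_zero] at h3
  exact h3

/-- **The typed first lemma of card `left-passage-foliation-lock` is false.** -/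
theorem not_foliationIdentification : ¬ FoliationIdentification := by
  intro h
  have hαβ : (0 : ℝ) < π := Real.pi_pos
  have h2π : π - 0 < 2 * π := by linarith [Real.pi_pos]
  obtain ⟨c₀, c₁, hc⟩ := h 0 π hαβ h2π Hf Hf id harmonicOnNhd_Hf continuousOn_Hf
    tendsto_Hf_one tendsto_Hf_zero (fun z _ => rfl)
  set M : ℝ := |c₀| + |c₁ - 1| with hM
  have hM0 : 0 ≤ M := by positivity
  have hM2 : M + 2 ≠ 0 := ne_of_gt (by linarith)
  set r : ℝ := (M + 1) / (M + 2) with hr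
  have hr0 : 0 ≤ r := by rw [hr]; positivity
  have hr1 : r < 1 := by rw [hr, div_lt_one (by linarith)]; linarith
  have hmem : ((r : ℝ) : ℂ) ∈ ball (0 : ℂ) 1 := by
    rw [mem_ball_zero_iff, Complex.norm_real, Real.norm_of_nonneg hr0]; exact hr1
  have hA0 : 0 ≤ Literature.Analysis.Complex.arcHM 0 π (r : ℂ) :=
    Literature.Analysis.Complex.arcHM_nonneg hαβ h2π hmem
  have hA1 : Literature.Analysis.Complex.arcHM 0 π (r : ℂ) ≤ 1 :=
    Literature.Analysis.Complex.arcHM_le_one 0 π _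
  have hcr : Literature.Analysis.Complex.arcHM 0 π (r : ℂ) + K (r : ℂ) =
      c₀ + c₁ * Literature.Analysis.Complex.arcHM 0 π (r : ℂ) := hc (r : ℂ) hmem
  -- upper bound from the alleged affine representation
  have hKle : K (r : ℂ) ≤ M := by
    have e : K (r : ℂ) = c₀ + (c₁ - 1) * Literature.Analysis.Complex.arcHM 0 π (r : ℂ) := by
      linarith
    have h1 : c₀ ≤ |c₀| := le_abs_self _
    have h2 : (c₁ - 1) * Literature.Analysis.Complex.arcHM 0 π (r : ℂ) ≤ |c₁ - 1| := by
      calc (c₁ - 1) * Literature.Analysis.Complex.arcHM 0 π (r : ℂ)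
          ≤ |(c₁ - 1) * Literature.Analysis.Complex.arcHM 0 π (r : ℂ)| := le_abs_self _
        _ = |c₁ - 1| * Literature.Analysis.Complex.arcHM 0 π (r : ℂ) := by
            rw [abs_mul, abs_of_nonneg hA0]
        _ ≤ |c₁ - 1| * 1 := by gcongr
        _ = |c₁ - 1| := mul_one _
    rw [e, hM]
    linarith
  -- lower bound from the explicit value on the radius
  have hKge : M + 1 < K (r : ℂ) := by
    rw [K_ofReal, lt_div_iff₀ (sub_pos.2 hr1)]
    have e : (M + 1) * (1 - r) = r := by rw [hr]; field_simp; ring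
    rw [e]
    linarith
  linarith

end Summit.CriticalPhenomena.CardyFormulaZ2.Cruxes.ParafermionToSLESixFamilies.Triage
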